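import Summits.QuantumFields.QCD.Theorems.HeatSlicedQuarksQuarkLoopCoefficientTorusToPlaneAuxC

/-!
# Helper D for stub `stub_torusToPlane` (line `Sketch`, crux `QuarkLoopCoefficient`, item stmt-QuantumFields-16786): periodization of the kernel powers

Continuation of `HeatSlicedQuarksQuarkLoopCoefficientTorusToPlaneAuxC`.  For a Cartan-diagonal
`SU(3)` field `U` on `(ℤ/L)⁴` and the pulled-back colour-`a` phases `ũ_a` on `ℤ⁴`:

* `fibre_sqKer`: `(D_Wᴴ D_W)((π x̃, a, α), (w, b, β)) = [a = b] Σ_{w̃ ∈ nbr2 x̃ ∩ π⁻¹ w} (sqKer ũ_a x̃ w̃)_{αβ}`;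
* `fibre_sqKerPow`: over the deck group `Lℤ⁴` (`L ≥ 1`),
  `((D_Wᴴ D_W)^m)((π x̃, a, α), (π ỹ, b, β)) = [a = b] Σ_{n ∈ ℤ⁴} (sqKerPow ũ_a m x̃ (ỹ + L n))_{αβ}`
  (a finitely supported `HasSum`);
* `sqKerPow_eq_zero_of_far`, `sqKerPow_deck_eq_zero`, `card_deckBox`: finite propagation speed of
  the kernel powers (`Hᵐ(x, y) = 0` unless `|y_μ − x_μ| ≤ 2m`) and the size of the box of deck labels
  that can contribute to a deck sum.

Finite bookkeeping; Mathlib + the Defs/HeatSeries/TorusToPlaneAuxC files.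
-/

noncomputable section

namespace Summit.QuantumFields.QCD.Cruxes.QuarkLoopCoefficient.Sketch.TorusToPlane

open Summit.QuantumFields.QCD.Theorems.QuarkLoopCoefficient
open Literature.MathematicalPhysics.QuantumLattice Literature.MathematicalPhysics.QuantumFieldTheory
open Literature.Probability.LatticeModels (Site TorusSite)
open Summit.QuantumFields.QCD.Cruxes.QuarkLoopCoefficient.Sketch.HeatSeries
open scoped Matrix ComplexConjugate

variable {L : ℕ} (U : GaugeConfig 4 L (Matrix.specialUnitaryGroup (Fin 3) ℂ))

/-! ### §4 Fibre identities for `D_Wᴴ D_W` and its powers -/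

/-- **Fibre identity for the squared operator.** For a Cartan-diagonal field,
`(D_Wᴴ D_W)((π x̃, a, α), (w, b, β)) = [a = b] · Σ_{w̃ ∈ nbr2 x̃, π w̃ = w} (sqKer ũ_a x̃ w̃)_{αβ}`. -/
theorem fibre_sqKer [NeZero L]
    (hdiag : ∀ (e : Edge 4 L) (i j : Fin 3), i ≠ j → (fundamentalRep (Fin 3)) (U e) i j = 0)
    (xt : Site 4) (a : Fin 3) (α : Fin 4) (w : TorusSite 4 L) (b : Fin 3) (β : Fin 4) :
    ((wilsonDirac (fundamentalRep (Fin 3)) U 0 1)ᴴ * wilsonDirac (fundamentalRep (Fin 3)) U 0 1)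
        ((fun ν => ((xt ν : ℤ) : ZMod L)), a, α) (w, b, β) =
      if a = b then
        (∑ wt ∈ (nbr2 xt).filter (fun wt => (fun ν => ((wt ν : ℤ) : ZMod L)) = w),
          sqKer (fun e => (fundamentalRep (Fin 3)) (U ((fun ν => ((e.1 ν : ℤ) : ZMod L)), e.2)) a a)
            xt wt) α β
      else 0 := by
  rw [Matrix.mul_apply]
  simp only [Matrix.conjTranspose_apply, Fintype.sum_prod_type]
  -- every `D(r, (π x̃, a, α))` through the column identity; the colour sum collapses to `c = a`
  simp only [wilsonDirac_col U hdiag]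
  rw [Finset.sum_congr rfl fun z _ => Finset.sum_eq_single a (fun c _ hca => by simp [hca])
    (fun h => absurd (Finset.mem_univ a) h)]
  simp only [if_true, Matrix.sum_apply, star_sum, Finset.sum_mul]
  -- ∑_z ∑_γ ∑_{zt ∈ fibre z} → ∑_z ∑_{zt ∈ fibre z} ∑_γ → ∑_{zt ∈ nbr xt} ∑_γ (at the site π zt)
  rw [Finset.sum_congr rfl fun z _ => Finset.sum_comm, sum_fibre_sum (nbr xt)]
  -- every `D((π zt, a, γ), (w, b, β))` through the row identity
  simp only [wilsonDirac_row U hdiag]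
  by_cases hab : a = b
  · subst hab
    simp only [if_true]
    -- right-hand side: ∑_{wt} ∑_{zt ∈ nbr xt} (D(zt,xt)ᴴ D(zt,wt))_{αβ}, swap and restrict the fibre
    unfold sqKer
    simp only [Matrix.sum_apply, Matrix.mul_apply, Matrix.conjTranspose_apply]
    conv_rhs => rw [Finset.sum_comm]
    refine Finset.sum_congr rfl fun zt hzt => ?_
    have hsub : (nbr zt).filter (fun wt => (fun ν => ((wt ν : ℤ) : ZMod L)) = w) ⊆
        (nbr2 xt).filter (fun wt => (fun ν => ((wt ν : ℤ) : ZMod L)) = w) := by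
      intro wt hwt
      rw [Finset.mem_filter] at hwt ⊢
      exact ⟨mem_nbr2.mpr ⟨zt, hzt, hwt.1⟩, hwt.2⟩
    rw [← Finset.sum_subset hsub]
    · rw [Finset.sum_comm]
      refine Finset.sum_congr rfl fun γ _ => ?_
      rw [Finset.mul_sum]
    · intro wt hwt2 hwt
      have hwt' : wt ∉ nbr zt := fun h' =>
        hwt (Finset.mem_filter.mpr ⟨h', (Finset.mem_filter.mp hwt2).2⟩)
      simp only [diracKer_eq_zero hwt', Matrix.zero_apply, mul_zero, Finset.sum_const_zero]
  · simp only [if_neg hab, mul_zero, Finset.sum_const_zero]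

/-- **Fibre identity for the kernel powers** over the deck group: for a Cartan-diagonal field and
`L ≥ 1`, `((D_Wᴴ D_W)^m)((π x̃, a, α), (π ỹ, b, β)) = [a = b] · Σ_{n ∈ ℤ⁴} (sqKerPow ũ_a m x̃ (ỹ + L n))_{αβ}`
as a (finitely supported) unconditional sum. Induction on `m` through `fibre_sqKer`. -/
theorem fibre_sqKerPow [NeZero L]
    (hdiag : ∀ (e : Edge 4 L) (i j : Fin 3), i ≠ j → (fundamentalRep (Fin 3)) (U e) i j = 0) :
    ∀ (m : ℕ) (xt : Site 4) (a : Fin 3) (α : Fin 4) (yt : Site 4) (b : Fin 3) (β : Fin 4),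
      HasSum (fun n : Site 4 => if a = b then
          sqKerPow (fun e => (fundamentalRep (Fin 3)) (U ((fun ν => ((e.1 ν : ℤ) : ZMod L)), e.2)) a a)
            m xt (yt + fun μ => (L : ℤ) * n μ) α β else 0)
        ((((wilsonDirac (fundamentalRep (Fin 3)) U 0 1)ᴴ * wilsonDirac (fundamentalRep (Fin 3)) U 0 1) ^ m)
          ((fun ν => ((xt ν : ℤ) : ZMod L)), a, α) ((fun ν => ((yt ν : ℤ) : ZMod L)), b, β)) := by
  intro m
  induction m with
  | zero =>
    intro xt a α yt b β
    rw [pow_zero, Matrix.one_apply]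
    simp only [sqKerPow_zero_apply]
    by_cases hfib : (fun ν => ((xt ν : ℤ) : ZMod L)) = fun ν => ((yt ν : ℤ) : ZMod L)
    · obtain ⟨n₀, hn₀⟩ := exists_deck_of_castSite_eq hfib
      by_cases hab : a = b
      · subst hab
        have hval : (if ((fun ν => ((xt ν : ℤ) : ZMod L)), a, α) = ((fun ν => ((yt ν : ℤ) : ZMod L)), a, β)
            then (1 : ℂ) else 0) =
            (if a = a then (if xt = yt + fun μ => (L : ℤ) * n₀ μ then (1 : Spin) else 0) α β else 0) := by
          rw [if_pos rfl, if_pos hn₀, Matrix.one_apply]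
          by_cases hαβ : α = β
          · rw [if_pos hαβ, if_pos]; rw [hfib, hαβ]
          · rw [if_neg hαβ, if_neg]; intro e; exact hαβ (Prod.mk.inj (Prod.mk.inj e).2).2
        rw [hval]
        refine hasSum_single n₀ fun n hn => ?_
        rw [if_pos rfl, if_neg, Matrix.zero_apply]
        intro e
        exact hn (deck_injective yt (hn₀.symm.trans e)).symm
      · have hval : (if ((fun ν => ((xt ν : ℤ) : ZMod L)), a, α) = ((fun ν => ((yt ν : ℤ) : ZMod L)), b, β)
            then (1 : ℂ) else 0) = 0 := by
          rw [if_neg]; intro e; exact hab (Prod.mk.inj (Prod.mk.inj e).2).1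
        rw [hval]
        simp only [if_neg hab]
        exact hasSum_zero
    · have hval : (if ((fun ν => ((xt ν : ℤ) : ZMod L)), a, α) = ((fun ν => ((yt ν : ℤ) : ZMod L)), b, β)
          then (1 : ℂ) else 0) = 0 := by
        rw [if_neg]; intro e; exact hfib (Prod.mk.inj e).1
      rw [hval]
      have hzero : (fun n : Site 4 => if a = b then
          (if xt = yt + fun μ => (L : ℤ) * n μ then (1 : Spin) else 0) α β else 0) = fun _ => 0 := by
        funext n
        split_ifs with hab hn
        · exact absurd ((congrArg (fun z : Site 4 => fun ν => ((z ν : ℤ) : ZMod L)) hn).trans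
            (castSite_add_deck yt n)) hfib
        · rfl
        · rfl
      rw [hzero]
      exact hasSum_zero
  | succ m ih =>
    intro xt a α yt b β
    rw [pow_succ', Matrix.mul_apply]
    simp only [Fintype.sum_prod_type]
    simp only [fibre_sqKer U hdiag]
    rw [Finset.sum_congr rfl fun z _ => Finset.sum_eq_single a (fun c _ hca => by simp [Ne.symm hca])
      (fun h => absurd (Finset.mem_univ a) h)]
    simp only [if_true, Matrix.sum_apply, Finset.sum_mul]
    rw [Finset.sum_congr rfl fun z _ => Finset.sum_comm, sum_fibre_sum (nbr2 xt)]
    -- the value is now ∑_{wt ∈ nbr2 xt} ∑_γ H(xt,wt)_{αγ} · (H^m)((π wt, a, γ), (π yt, b, β))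
    have key := hasSum_sum (s := nbr2 xt) fun wt _ => hasSum_sum (s := (Finset.univ : Finset (Fin 4)))
      fun γ _ => (ih wt a γ yt b β).mul_left
        (sqKer (fun e => (fundamentalRep (Fin 3)) (U ((fun ν => ((e.1 ν : ℤ) : ZMod L)), e.2)) a a)
          xt wt α γ)
    refine key.congr_fun fun n => ?_
    by_cases hab : a = b
    · simp only [if_pos hab, sqKerPow_succ, Matrix.sum_apply, Matrix.mul_apply]
    · simp only [if_neg hab, mul_zero, Finset.sum_const_zero]

/-! ### §5 Finite propagation speed of the kernel powers -/

/-- Neighbours differ by at most one in every coordinate. -/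
theorem abs_sub_le_one_of_mem_nbr {x y : Site 4} (h : y ∈ nbr x) (μ : Fin 4) : |y μ - x μ| ≤ 1 := by
  rcases mem_nbr.mp h with rfl | ⟨ν, rfl | rfl⟩
  · simp
  · by_cases hμν : μ = ν
    · subst hμν; simp
    · simp [hμν]
  · by_cases hμν : μ = ν
    · subst hμν; simp
    · simp [hμν]

/-- Second neighbours differ by at most two in every coordinate. -/
theorem abs_sub_le_two_of_mem_nbr2 {x y : Site 4} (h : y ∈ nbr2 x) (μ : Fin 4) : |y μ - x μ| ≤ 2 := by
  obtain ⟨z, hz, hy⟩ := mem_nbr2.mp h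
  have h1 := abs_sub_le_one_of_mem_nbr hz μ
  have h2 := abs_sub_le_one_of_mem_nbr hy μ
  have tri := abs_sub_le (y μ) (z μ) (x μ)
  linarith

/-- **Finite propagation speed**: `Hᵐ(x, y) = 0` unless `|y_μ − x_μ| ≤ 2m` for every `μ`. -/
theorem sqKerPow_eq_zero_of_far (u : LGConfig 4 ℂ) :
    ∀ (m : ℕ) (x y : Site 4), (∃ μ, 2 * (m : ℤ) < |y μ - x μ|) → sqKerPow u m x y = 0 := by
  intro m
  induction m with
  | zero =>
    rintro x y ⟨μ, hμ⟩
    rw [sqKerPow_zero_apply, if_neg]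
    rintro rfl
    simp at hμ
  | succ m ih =>
    rintro x y ⟨μ, hμ⟩
    rw [sqKerPow_succ]
    refine Finset.sum_eq_zero fun z hz => ?_
    have h2 := abs_sub_le_two_of_mem_nbr2 hz μ
    have tri := abs_sub_le (y μ) (z μ) (x μ)
    rw [ih z y ⟨μ, by push_cast at hμ ⊢; linarith⟩, Matrix.mul_zero]

/-- Along a fibre of the covering, the `m`-th kernel power from `x̃` vanishes outside the box of deck
labels `|n_μ| ≤ 2m + Σ_ν |x̃_ν − ỹ_ν|` (for `L ≥ 1`). -/
theorem sqKerPow_deck_eq_zero [NeZero L] (u : LGConfig 4 ℂ) (m : ℕ) (xt yt n : Site 4)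
    (hn : n ∉ Fintype.piFinset fun _ : Fin 4 =>
      Finset.Icc (-(2 * (m : ℤ) + ∑ ν, |xt ν - yt ν|)) (2 * (m : ℤ) + ∑ ν, |xt ν - yt ν|)) :
    sqKerPow u m xt (yt + fun μ => (L : ℤ) * n μ) = 0 := by
  rw [Fintype.mem_piFinset, not_forall] at hn
  obtain ⟨μ, hμ⟩ := hn
  rw [Finset.mem_Icc, not_and_or, not_le, not_le] at hμ
  refine sqKerPow_eq_zero_of_far u m xt _ ⟨μ, ?_⟩
  have hL : (1 : ℤ) ≤ (L : ℤ) := by exact_mod_cast Nat.one_le_iff_ne_zero.mpr (NeZero.ne L)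
  have hd : |xt μ - yt μ| ≤ ∑ ν, |xt ν - yt ν| :=
    Finset.single_le_sum (f := fun ν => |xt ν - yt ν|) (fun ν _ => abs_nonneg _) (Finset.mem_univ μ)
  simp only [Pi.add_apply]
  -- |yt μ + L n μ - xt μ| ≥ L |n μ| - |xt μ - yt μ| ≥ |n μ| - d > 2m
  have key : |(L : ℤ) * n μ| ≤ |yt μ + (L : ℤ) * n μ - xt μ| + |xt μ - yt μ| := by
    have := abs_add_le (yt μ + (L : ℤ) * n μ - xt μ) (xt μ - yt μ)
    rwa [show yt μ + (L : ℤ) * n μ - xt μ + (xt μ - yt μ) = (L : ℤ) * n μ by ring] at this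
  have hLn : |n μ| ≤ |(L : ℤ) * n μ| := by
    rw [abs_mul, Nat.abs_cast]
    exact le_mul_of_one_le_left (abs_nonneg _) hL
  rcases hμ with h | h
  · have : |n μ| = -n μ := abs_of_neg (by
      have : (0 : ℤ) ≤ 2 * (m : ℤ) + ∑ ν, |xt ν - yt ν| := by positivity
      linarith)
    linarith
  · have : |n μ| = n μ := abs_of_pos (by
      have : (0 : ℤ) ≤ 2 * (m : ℤ) + ∑ ν, |xt ν - yt ν| := by positivity
      linarith)
    linarith

/-- Cardinality of the box of deck labels: `(2K + 1)⁴`. -/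
theorem card_deckBox (K : ℤ) (hK : 0 ≤ K) :
    ((Fintype.piFinset fun _ : Fin 4 => Finset.Icc (-K) K).card : ℝ) = (2 * K + 1) ^ 4 := by
  rw [Fintype.card_piFinset, Finset.prod_const, Finset.card_univ, Fintype.card_fin, Nat.cast_pow]
  congr 1
  have h := Int.card_Icc_of_le (a := -K) (b := K) (by linarith)
  have h' : (((Finset.Icc (-K) K).card : ℤ) : ℝ) = ((K + 1 - -K : ℤ) : ℝ) := by rw [h]
  push_cast at h'
  linarith [h']

/-- `4m + 1 ≤ 5ᵐ`. -/
theorem four_mul_add_one_le_pow (m : ℕ) : (4 * (m : ℝ) + 1) ≤ 5 ^ m := by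
  induction m with
  | zero => norm_num
  | succ m ih =>
    have h5 : (1 : ℝ) ≤ 5 ^ m := one_le_pow₀ (by norm_num)
    push_cast
    calc 4 * ((m : ℝ) + 1) + 1 = (4 * (m : ℝ) + 1) + 4 := by ring
      _ ≤ 5 ^ m + 4 * 5 ^ m := by linarith
      _ = 5 ^ (m + 1) := by rw [pow_succ]; ring

/-! ### Registered headline -/

/-- Registered headline of this helper file (aux stub `stub_torusToPlaneAuxD` of crux
stmt-QuantumFields-16786, line `Sketch`): periodization of the kernel powers of a Cartan-diagonal
field over the deck group of the universal cover. -/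
theorem stub_torusToPlaneAuxD :
    ∀ (L : ℕ) [NeZero L] (U : GaugeConfig 4 L (Matrix.specialUnitaryGroup (Fin 3) ℂ)),
      (∀ (e : Edge 4 L) (i j : Fin 3), i ≠ j → (fundamentalRep (Fin 3)) (U e) i j = 0) →
      ∀ (m : ℕ) (xt : Site 4) (a : Fin 3) (α : Fin 4) (yt : Site 4) (b : Fin 3) (β : Fin 4),
        HasSum (fun n : Site 4 => if a = b then
            sqKerPow (fun e => (fundamentalRep (Fin 3)) (U ((fun ν => ((e.1 ν : ℤ) : ZMod L)), e.2)) a a)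
              m xt (yt + fun μ => (L : ℤ) * n μ) α β else 0)
          ((((wilsonDirac (fundamentalRep (Fin 3)) U 0 1)ᴴ * wilsonDirac (fundamentalRep (Fin 3)) U 0 1) ^ m)
            ((fun ν => ((xt ν : ℤ) : ZMod L)), a, α) ((fun ν => ((yt ν : ℤ) : ZMod L)), b, β)) :=
  fun _ _ U hdiag => fibre_sqKerPow U hdiag

end Summit.QuantumFields.QCD.Cruxes.QuarkLoopCoefficient.Sketch.TorusToPlane

end
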